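import Summits.HubbardSuperconductivity.HubbardSuperconductivity.Theorems.BalabanIRBirComplexStableXYRStubThinFormCoercive
import Summits.HubbardSuperconductivity.HubbardSuperconductivity.Theorems.BalabanIRBirComplexStableXYRStubCurlNormBound
import HarnessLib

/-!
# Route `BalabanIR`, crux `BirComplexStableXYR` (item `stmt-HubbardSuperconductivity-14845`),
# line `fat-gaussian-defect-calculus`: stub V2 `stub_vortexCost`

Helper (`--supports`) for the crux
`Summit.HubbardSuperconductivity.HubbardSuperconductivity.Theses.BalabanIR.BirComplexStableXYR`,
line `fat-gaussian-defect-calculus` (lead skeleton `Cruxes/BirComplexStableXYR/Lines/fat_gaussian_defect_calculus.lean`),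
stub V2 `stub_vortexCost`: the **volume-uniform Gaussian vortex cost** of the exact Fröhlich–Spencer unfolding on the
space–time torus `Λ L M = (Fin 2 → ZMod L) × ZMod M` (chart `TorusChart.piProdZMod 2 L M`, three directions).

**Statement.** For a window Fourier table `c : Table r` (`r ≥ 2`) with (N) `Σ_n c_n = 0` and the coercivity (C)
`c₀ ΣΣ (1 − cos(φ_w − φ_w')) ≤ Re F(φ)`, the thin form `𝒬(ω) = Σ_s Q(P ω s)` (window Hessian form `Q` of the window
path configurations `P ω s` of a real `1`-cochain `ω`, both given by their defining equations `hQ`, `hP`) pays, on the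
Coulomb strain `ω = 2πa − d₀ψ` of an integer `1`-cochain `a` and ANY real `0`-cochain `ψ`, at least
`(π² c₀ / 6) · Σ_{x,i,j} (d₁ a)(x;i,j)²`.

**Proof.** Chain three landed facts: coercivity of the thin form on all real `1`-cochains
(`stub_thinFormCoercive`, P1e: `2c₀ ‖ω‖² ≤ 𝒬(ω)`), the curl-norm bound with `d = 3`
(`stub_curlNormBound`, V1: `‖d₁ω‖² ≤ 48 ‖ω‖²`) and `d₁(2πa − d₀ψ) = 2π · d₁a` (`d₁ ∘ d₀ = 0`,
`TorusChart.d₁_two_pi_mul_intCast_sub_d₀`), so that `(π²c₀/6) Σ (d₁a)² = (c₀/24) ‖d₁ω‖² ≤ 2c₀ ‖ω‖² ≤ 𝒬(ω)`.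
Elementary; no definition and no named fact is introduced; sorry-free. [folklore]
-/

set_option linter.dupNamespace false -- `Summit.<S>.<S>.Theorems…` repeats the summit name (D-0017 layout)

namespace Summit.HubbardSuperconductivity.HubbardSuperconductivity.Theorems.FSUnfolding

open scoped BigOperators
open Literature.MathematicalPhysics.QuantumFieldTheory Literature.Probability.LatticeModels
open Summit.HubbardSuperconductivity.BirComplexStableXYNegative

/-- **Stub V2 `stub_vortexCost` (registered signature, verbatim): the volume-uniform Gaussian vortex cost.**  Under
(N) and (C) (window range `r ≥ 2`), for every integer `1`-cochain `a` and every real `0`-cochain `ψ` of `Λ L M` the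
thin form `Σ_s Q(P ω s)` evaluated on the strain `ω = 2πa − d₀ψ` dominates `(π² c₀ / 6) · Σ_{x,i,j} (d₁ a)(x;i,j)²`:
coercivity `2c₀‖ω‖² ≤ Σ_s Q(P ω s)` (`stub_thinFormCoercive`), the curl bound `‖d₁ω‖² ≤ 48‖ω‖²`
(`stub_curlNormBound` with `d = 3`) and `d₁ω = 2π·d₁a` (`d₁ ∘ d₀ = 0`). [folklore] -/
theorem stub_vortexCost :
    ∀ (r : ℕ) (c : Table r) (c₀ : ℝ), 2 ≤ r → 0 < c₀ → c.sum (fun _ a => a) = 0 →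
      (∀ φ : W r → ℝ, c₀ * ∑ w, ∑ w', (1 - Real.cos (φ w - φ w')) ≤ (genF c φ).re) →
      ∀ (L M : ℕ) [NeZero L] [NeZero M]
      (P : (Λ L M → Fin 3 → ℝ) → Λ L M → W r → ℝ),
      (∀ (ω : Λ L M → Fin 3 → ℝ) (s : Λ L M) (w : W r), P ω s w =
        (TorusChart.piProdZMod 2 L M).lineSum ω 0 (w.1 : ℕ) s
          + (TorusChart.piProdZMod 2 L M).lineSum ω 1 (w.2.1 : ℕ) (s + (w.1 : ℕ) • (TorusChart.piProdZMod 2 L M).gen 0)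
          + (TorusChart.piProdZMod 2 L M).lineSum ω 2 (w.2.2 : ℕ)
            (s + (w.1 : ℕ) • (TorusChart.piProdZMod 2 L M).gen 0 + (w.2.1 : ℕ) • (TorusChart.piProdZMod 2 L M).gen 1)) →
      ∀ (Q : (W r → ℝ) → ℝ),
      (∀ u : W r → ℝ, Q u = (-c.sum (fun n a => a * (((∑ w, (n w : ℝ) * u w) ^ 2 : ℝ) : ℂ))).re) →
      ∀ (a : Λ L M → Fin 3 → ℤ) (ψ : Λ L M → ℝ),
        Real.pi ^ 2 * c₀ / 6 * ∑ x : Λ L M, ∑ i : Fin 3, ∑ j : Fin 3,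
            (((TorusChart.piProdZMod 2 L M).d₁ a x i j : ℤ) : ℝ) ^ 2 ≤
          ∑ s : Λ L M, Q (P (fun x i => 2 * Real.pi * (a x i : ℝ) - (TorusChart.piProdZMod 2 L M).d₀ ψ x i) s) := by
  intro r c c₀ hr hc₀ hN hC L M _ _ P hP Q hQ a ψ
  set F := TorusChart.piProdZMod 2 L M
  set ω : Λ L M → Fin 3 → ℝ := fun x i => 2 * Real.pi * (a x i : ℝ) - F.d₀ ψ x i with hω
  -- (1) coercivity of the thin form on the strain `ω`
  have h1 : 2 * c₀ * ∑ x, ∑ i, (ω x i) ^ 2 ≤ ∑ s, Q (P ω s) := by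
    have h := stub_thinFormCoercive r c c₀ hr hc₀ hN hC L M ω
    simp only [hQ, hP]
    exact h
  -- (2) the curl-norm bound with `d = 3`
  have h2 : ∑ x, ∑ i, ∑ j, (F.d₁ ω x i j) ^ 2 ≤ 16 * ((3 : ℕ) : ℝ) * ∑ x, ∑ i, (ω x i) ^ 2 :=
    stub_curlNormBound (Λ L M) 3 F ω
  have h48 : (16 * ((3 : ℕ) : ℝ)) = 48 := by norm_num
  rw [h48] at h2
  -- (3) the curl of the strain is `2π` times the integer curl of `a`
  have hcurl : ∑ x, ∑ i, ∑ j, (F.d₁ ω x i j) ^ 2 =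
      4 * Real.pi ^ 2 * ∑ x, ∑ i, ∑ j, ((F.d₁ a x i j : ℤ) : ℝ) ^ 2 := by
    rw [Finset.mul_sum]
    refine Finset.sum_congr rfl fun x _ => ?_
    rw [Finset.mul_sum]
    refine Finset.sum_congr rfl fun i _ => ?_
    rw [Finset.mul_sum]
    refine Finset.sum_congr rfl fun j _ => ?_
    rw [hω, F.d₁_two_pi_mul_intCast_sub_d₀]
    ring
  -- (4) chain
  calc Real.pi ^ 2 * c₀ / 6 * ∑ x, ∑ i, ∑ j, ((F.d₁ a x i j : ℤ) : ℝ) ^ 2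
      = c₀ / 24 * ∑ x, ∑ i, ∑ j, (F.d₁ ω x i j) ^ 2 := by rw [hcurl]; ring
    _ ≤ c₀ / 24 * (48 * ∑ x, ∑ i, (ω x i) ^ 2) :=
        mul_le_mul_of_nonneg_left h2 (div_nonneg hc₀.le (by norm_num))
    _ = 2 * c₀ * ∑ x, ∑ i, (ω x i) ^ 2 := by ring
    _ ≤ _ := h1

end Summit.HubbardSuperconductivity.HubbardSuperconductivity.Theorems.FSUnfolding
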